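import Summits.ABC.ABC.Theses.DefiniteXi
import Summits.ABC.ABC.Theorems.DefiniteXiDefiniteRTControlPrimeOfTakahashi
import Summits.ABC.ABC.Theorems.IsogenyGlueCongruenceMazurKenkuBoundOfRadius
import Literature.NumberTheory.EllipticCurves.ManinConstantArbitraryParametrizationIntegralProofs
import HarnessLib

/-!
# STUB-IDEAS k1 · gen 18 companion — typed doors for `stub_pasten163`
(crux stmt-ABC-11338 `DefiniteXi.DefiniteRTControlPrime`; stub signature
`PastenShimura2024_minimalDegree_le_163_mul`). Scratch only (ideation seat): every declaration is a
one-line import from a landed theorem; zero `sorry`.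
-/

set_option linter.dupNamespace false

namespace Summit.ABC.ABC.Cruxes.DefiniteRTControlPrime.StubIdeasK1G18

open Literature.NumberTheory.EllipticCurves Literature.NumberTheory.EllipticCurves.ModularForms

/-- D0 · TREE MATCH: the stub is route item `MazurKenkuBound` (stmt-ABC-15125) verbatim — both copies. -/
theorem door_item_defeq :
    Summit.ABC.ABC.Theses.DefiniteXi.MazurKenkuBound ↔ PastenShimura2024_minimalDegree_le_163_mul :=
  Iff.rfl

theorem door_item_defeq' :
    Summit.ABC.ABC.Theses.IsogenyGlueCongruence.MazurKenkuBound ↔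
      PastenShimura2024_minimalDegree_le_163_mul :=
  Iff.rfl

/-- D1 · import from item stmt-ABC-15125 (the whole verbatim stub, once that item closes). -/
theorem stub_pasten163_of_item (h : Summit.ABC.ABC.Theses.DefiniteXi.MazurKenkuBound) :
    PastenShimura2024_minimalDegree_le_163_mul := h

/-- D2 · import from the RADIUS item stmt-ABC-15193 (Edixhoven integrality already discharged in tree). -/
theorem stub_pasten163_of_radius
    (hRad : Summit.ABC.ABC.Theses.RibetTakahashiSplit.MazurKenkuRadius) :
    PastenShimura2024_minimalDegree_le_163_mul :=
  Summit.ABC.ABC.Theorems.mazurKenkuBound_of_radiusItem hRad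

/-- D3 · import from the Literature named fact (Mazur 1978 Thm 1 + Kenku 1982, list form). -/
theorem stub_pasten163_of_mazurKenku (hMK : mazurKenku_exists_cyclic_isogeny) :
    PastenShimura2024_minimalDegree_le_163_mul :=
  PastenShimura2024_minimalDegree_le_163_mul_of_mazurKenku' hMK

-- N1 (by reference only; module `Theorems/MazurKenkuBound/Negative/Necessity.lean` is outside the farm's built closure):
-- `Summit.ABC.ABC.Theorems.MazurKenkuBound.Negative.den_sq_le_of_mazurKenkuBound : MazurKenkuBound → … → q₀.den ^ 2 ≤ 163`.

/-- I1 · IDLENESS: the crux BY NAME from Takahashi 2001 Thm 2.3 (coprime form) ALONE — landed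
p839521; `stub_pasten163` occurs on no closing path. -/
theorem crux_of_takahashi :
    takahashi2001_thm_2_3_of_coprime → Summit.ABC.ABC.Theses.DefiniteXi.DefiniteRTControlPrime :=
  Summit.ABC.ABC.Theorems.DefiniteRTControlPrime.definiteRTControlPrime_of_takahashi

end Summit.ABC.ABC.Cruxes.DefiniteRTControlPrime.StubIdeasK1G18
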